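import Mathlib.Algebra.Group.ULift
import Literature.AnabelianGeometry.AbsoluteAnabelian.GaloisTheaters
import HarnessLib

/-!
# [AbsTopIII] Def 5.1 (ii): `InnerCompatible f g e` (FACT-LIST F-0107) is VOCABULARY — a schema whose
# universal closure is refutable; the instance forms the §5 records use are its equivalence-relation laws

S. Mochizuki, *Topics in absolute anabelian geometry III: global reconstruction algorithms*
[MochizukiAbsTopIII2015], Def 5.1 (ii) p. 114 (author's manuscript pagination, lit key
`paper:url-5493eb38cbb7`): the outer isomorphisms "`δ_{ell,v} : Δ_X ⥲ π₁(X_{ell,v})^∧`" and, in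
Def 5.1 (iii) p. 115, the conditions "compatible with `δ_{ell,v}`, `δ_v`" on the isomorphisms `ψ_v`, `φ_v` —
conditions on OUTER homomorphisms, which the trunk file `GaloisTheaters.lean` (abc-iut-L4-t3) records through
representatives and the 3-place relation

  `InnerCompatible f g e := ∃ c, ∀ a, g (e a) = c * f a * c⁻¹`

("`g ∘ e` agrees with `f` up to an inner automorphism of the common target").

PROOF-ONLY companion (no `def` / `instance` / `structure`), abc-iut cell seat abc-iut-f-097 (block F, tranche 97).
FACT-LIST row **F-0107** lists the bare predicate `InnerCompatible` as a `fact-open` named fact of class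
`preparatory`, kernel_closedness `parametrised`.  It is a DEFINITION schema over free binders
`A B C [Group C] f g e`; its universal closure is false (already `f = 1`, `g = e = id` in any nontrivial group),
so the row is admissible only through its INSTANCE forms (R5).  The instances the consumers use
(`IsReferenceIsoFor`, `GlobalGaloisTheater.Hom.arch_compat`, `GlobalAnabelianContext.refl_isReferenceIsoFor`,
`TPairs.IsTPairReferenceFor`, `TPairs.Hom.φarc_kummer`) are exactly the laws making "agree up to an inner
automorphism" an equivalence-type relation, all kernel theorems below:

* `InnerCompatible.of_eq`, `InnerCompatible.refl` — pointwise agreement (in particular `f`, `f`, `id`) is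
  inner-compatible (conjugator `c = 1`; this is the instance discharged inline in `refl_isReferenceIsoFor`);
* `InnerCompatible.symm`, `InnerCompatible.trans`, `InnerCompatible.map` — symmetry along an equivalence,
  transitivity (conjugators multiply), stability under a homomorphism of the target;
* `InnerCompatible.iff_forall_eq_of_comm` — in a commutative target the relation IS pointwise agreement;
* `not_innerCompatible_one_id`, `exists_not_innerCompatible`, `not_forall_innerCompatible` — the universal
  closure of F-0107 is false (witness: any nontrivial group, e.g. `ULift (Multiplicative ℤ)`).

HONEST FRAMING: bookkeeping about the cell's own typing of Def 5.1 (ii); nothing of [AbsTopIII] is asserted or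
denied; a refuted closure is a statement about the schema, not about the paper; nothing here bears on the
disputed [IUTchIII] Cor. 3.12; typed ≠ proved.
-/

namespace Literature.AnabelianGeometry.AbsoluteAnabelian

universe u

namespace InnerCompatible

variable {A B C : Type u} [Group C]

/-- Pointwise agreement `g ∘ e = f` is inner-compatibility with conjugator `1`.
[cite: MochizukiAbsTopIII2015, Def 5.1 (ii) p. 114] -/
theorem of_eq {f : A → C} {g : B → C} {e : A → B} (h : ∀ a, g (e a) = f a) : InnerCompatible f g e :=
  ⟨1, fun a => by rw [h a, one_mul, inv_one, mul_one]⟩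

/-- Reflexivity: `f` is inner-compatible with itself along the identity (the instance discharged inline in
`GlobalAnabelianContext.refl_isReferenceIsoFor`). [cite: MochizukiAbsTopIII2015, Def 5.1 (ii) p. 114] -/
theorem refl (f : A → C) : InnerCompatible f f id :=
  of_eq fun _ => rfl

/-- Symmetry along an equivalence `e : A ≃ B`: if `g ∘ e ~ f` then `f ∘ e⁻¹ ~ g` (conjugator `c⁻¹`).
[cite: MochizukiAbsTopIII2015, Def 5.1 (ii) p. 114] -/
theorem symm {f : A → C} {g : B → C} {e : A ≃ B} (h : InnerCompatible f g e) :
    InnerCompatible g f e.symm := by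
  obtain ⟨c, hc⟩ := h
  refine ⟨c⁻¹, fun b => ?_⟩
  have hb := hc (e.symm b)
  rw [e.apply_symm_apply] at hb
  rw [hb, inv_inv, ← mul_assoc, ← mul_assoc, inv_mul_cancel, one_mul, mul_assoc, inv_mul_cancel, mul_one]

/-- Transitivity: conjugators multiply. [cite: MochizukiAbsTopIII2015, Def 5.1 (ii) p. 114] -/
theorem trans {B' : Type u} {f : A → C} {g : B → C} {k : B' → C} {e : A → B} {e' : B → B'}
    (h : InnerCompatible f g e) (h' : InnerCompatible g k e') : InnerCompatible f k (e' ∘ e) := by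
  obtain ⟨c, hc⟩ := h
  obtain ⟨c', hc'⟩ := h'
  refine ⟨c' * c, fun a => ?_⟩
  rw [Function.comp_apply, hc', hc, mul_inv_rev, ← mul_assoc, ← mul_assoc, mul_assoc (c' * c * f a)]

/-- Stability under a homomorphism of the target group. [cite: MochizukiAbsTopIII2015, Def 5.1 (ii) p. 114] -/
theorem map {f : A → C} {g : B → C} {e : A → B} (h : InnerCompatible f g e) {D : Type u} [Group D]
    (φ : C →* D) : InnerCompatible (φ ∘ f) (φ ∘ g) e := by
  obtain ⟨c, hc⟩ := h
  exact ⟨φ c, fun a => by rw [Function.comp_apply, Function.comp_apply, hc, map_mul, map_mul, map_inv]⟩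

/-- In a commutative target, inner-compatibility is pointwise agreement.
[cite: MochizukiAbsTopIII2015, Def 5.1 (ii) p. 114] -/
theorem iff_forall_eq_of_comm {C : Type u} [CommGroup C] {f : A → C} {g : B → C} {e : A → B} :
    InnerCompatible f g e ↔ ∀ a, g (e a) = f a := by
  refine ⟨fun ⟨c, hc⟩ a => ?_, of_eq⟩
  rw [hc a, mul_comm c, mul_inv_cancel_right]

end InnerCompatible

/-- **F-0107 is a schema**: in any nontrivial group the constant map `1` is NOT inner-compatible with the
identity along the identity (`a = c·1·c⁻¹ = 1` fails at `a ≠ 1`). [cite: MochizukiAbsTopIII2015, Def 5.1 (ii) p. 114] -/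
theorem not_innerCompatible_one_id (C : Type u) [Group C] [Nontrivial C] :
    ¬ InnerCompatible (fun _ : C => (1 : C)) id id := by
  rintro ⟨c, hc⟩
  obtain ⟨a, ha⟩ := exists_ne (1 : C)
  apply ha
  have h := hc a
  rwa [mul_one, mul_inv_cancel] at h

/-- At every nontrivial target group SOME data `(f, g, e)` violate `InnerCompatible`: the relation is a genuine
condition, not a property of the carrier. [cite: MochizukiAbsTopIII2015, Def 5.1 (ii) p. 114] -/
theorem exists_not_innerCompatible (C : Type u) [Group C] [Nontrivial C] :
    ∃ (f g : C → C) (e : C → C), ¬ InnerCompatible f g e :=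
  ⟨fun _ => 1, id, id, not_innerCompatible_one_id C⟩

/-- **The universal closure of F-0107 is false** (witness: the nontrivial group `ULift (Multiplicative ℤ)`,
`f = 1`, `g = e = id`). [cite: MochizukiAbsTopIII2015, Def 5.1 (ii) p. 114] -/
theorem not_forall_innerCompatible :
    ¬ ∀ (A B C : Type u) (_ : Group C) (f : A → C) (g : B → C) (e : A → B), InnerCompatible f g e :=
  fun h => not_innerCompatible_one_id (ULift.{u} (Multiplicative ℤ))
    (h _ _ (ULift.{u} (Multiplicative ℤ)) inferInstance (fun _ => 1) id id)

end Literature.AnabelianGeometry.AbsoluteAnabelian
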